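import Summits.QuantumFields.YangMills.Theorems.BalabanUVNodesN07Thm4RecMemberOfCrown
import HarnessLib

/-!
# N07 [B11] — «N05-REC» R7 → THE KNIT: the member-row premise `HThm4RecMember` AT THE PRINT LETTERS `b9OfP ∕ a0OfP` from the datum crown `DatumCrownAt`
# ([Balaban1985RegularSpaces] Prop. 6 p. 99 radius `7dL²(5dLB₀)·M′·α₀` and guard `7dL²·M′·α₀ ≤ c₁` ↦ [Balaban1985Variational] (152)'s letter `B₉ = b9OfP` and ceiling `a₀ = a0OfP`)

statement-level skeleton of published theorems with citation tags; proofs where landed; nothing here is a claim about the Yang–Mills mass gap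

Cell `pub-ymgap`, node N07 = [B11] (key item K1⁷; this file is a COUNT-NEUTRAL helper keyed K0⁷ `stmt-QuantumFields-20541` per the chair's KEY MAP v2), seat
`pub-ymgap-dag-n07-w3` (g11; WIDTH SEAT 3 of 4; «N05-REC» R7 = the knit of dag-n05-e's R6 crown into dag-n07-e's premise of record).  INTENT-7 on the cell bus 2026-08-29 15:21Z.

WHY.  g11's p721358 (`…N07Thm4RecMemberOfCrown`) proved ★★★ `hThm4RecMember_of_datumCrownAt`: the member-row premise `HThm4RecMember F N Mc ρ hρ κ a₀` (dag-n07-e's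
`HThm4RecDbar` MODULE 88″ :80–111 with row 9 replaced by the door's member rows) from the displayed datum crown `DatumCrownAt F N Mc ρ hρ Cr α₁` (R6 = [6] Prop. 6 ∕ [15]
(152)–(153) at the print datum, radius `Cr·α` at tolerance `α ≤ α₁`), for ANY `(κ, a₀)` with `4·Cr·L⁶ < κ`, `L³·a₀ ≤ α₁`, `4N·Cr·L³·a₀ < 2π`.  The premise OF RECORD, however, is
read at dag-n07-e's PRINT LETTERS (`Node00/TorusCoverGaugeTokensRPrint`): `κ := b9OfP F Mc ρ B₁ = 112·L⁵·B₁·(L·Mc + 44 + 2ρ) + 1` ([15] (152) «9dL²B₁Mε₀», doubled, `+1`) and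
`a₀ := a0OfP F N Mc ρ B₁ c₁ = min (c₁ ∕ (56·L⁵·(L·Mc + 44 + 2ρ))) (1 ∕ (8·(L·Mc + 44 + 2ρ)·N·(28·L⁵·B₁·(L·Mc + 44 + 2ρ)) + 1))` ([15] (152) «9dL²Mε₀ ≦ c₁» and the `2π`
window), in the collar-uniform shape `HThm4RecDbarUniform F N Mc` (88″ §2: `∃ ρmin B₁ c₁, … ∀ ρ₀, ρmin ∣ ρ₀ → 1 ≤ ρ₀ → HThm4RecDbar F N Mc (ρ₀·L) (b9OfP …) (a0OfP …)`).
THIS FILE is the part of the junction «R6 crown → premise of record» that does NOT depend on the final text of dag-n05-e's record crown (`…ScalarGammaHoldsRec`, pending):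
[6] Prop. 6's radius has the shape `Cr·α₀` with `Cr = 7·d·L²·(5dLB₀)·M′` and its guard is `7·d·L²·M′·α₀ ≤ c₁` (`d = 4`, `M′ = sideP ≤ L·Mc + 44 + 2ρ`) — fixed by the engine
crown `B8Prop6DentedCubeMemberScalarGammaHolds.gaugedBoundB8D_dentedMember_scalar_γ_holds` and dag-n05-e's record (g)-1 `B8Prop6DentedCubeMemberGaugedRec.gaugedBoundB8D_of_clauses`
— and at these shapes the three side conditions of `hThm4RecMember_of_datumCrownAt` hold AT THE PRINT LETTERS with `B₁ := 20·L⁴·B₀`: `4·Cr·L⁶ ≤ 2240·L⁹·B₀·(L·Mc+44+2ρ) =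
b9OfP − 1 < b9OfP`; `L³·a0OfP ≤ c₁ ∕ (56·L²·(L·Mc+44+2ρ)) ≤ α₁`; `4N·Cr·L³·a0OfP ≤ 2240·N·L⁶·B₀·S′ ∕ (4480·N·L⁹·B₀·S′² + 1) ≤ 1 < 2π`.

WHAT THIS FILE PROVES (sorry-free; real arithmetic over p721358 BY NAME).
§1 `b9OfP_twenty` · `a0OfP_le_first` · `a0OfP_le_second` (the letters unfolded; bookkeeping); `le_mul_collar` (`1 ≤ ρ₀ → F.L ≤ ρ₀·F.L`).
§2 ★★ `hThm4RecMember_printLetters_of_datumCrownAt {Mc ρ} (hρ) {Cr α₁ B₀ c₁} (hB₀ : 0 < B₀) (hc₁ : 0 < c₁) (hCr : 0 ≤ Cr) (hCrB : Cr ≤ 560·L³·B₀·(L·Mc + 44 + 2ρ))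
   (hα₁ : c₁ ∕ (56·L²·(L·Mc + 44 + 2ρ)) ≤ α₁) (hcrown : DatumCrownAt F N Mc ρ hρ Cr α₁) : HThm4RecMember F N Mc ρ hρ (b9OfP F Mc ρ (20·L⁴·B₀)) (a0OfP F N Mc ρ (20·L⁴·B₀) c₁)`;
   ★ `hThm4RecMember_printLetters_of_datumCrownAt_sideP` — the same read at the crown's own constants `Cr := 560·L³·B₀·M′`, `α₁ := c₁ ∕ (28·L²·M′)`, `M′ = sideP (F.P 0) Mc ρ`
   (`sideP_le`: `M′ ≤ Mc + 44 + 2ρ ≤ L·Mc + 44 + 2ρ`).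
§3 ★★ `hThm4RecMember_printLetters_uniform_of_datumCrownAt` — the COLLAR-UNIFORM shape of 88″ §2 with `HThm4RecDbar ↦ HThm4RecMember`: from the datum crown at every admissible
   collar `ρ₀·L` (`ρmin ∣ ρ₀`, `1 ≤ ρ₀`) with radii `Cr ρ₀ ≤ 560·L³·B₀·(L·Mc + 44 + 2ρ₀L)` and tolerances `α₁ ρ₀ ≥ c₁ ∕ (56·L²·(L·Mc + 44 + 2ρ₀L))`, the witness `(B₁, c₁) :=
   (20·L⁴·B₀, c₁)` serves every collar: `∀ ρ₀, ρmin ∣ ρ₀ → 1 ≤ ρ₀ → ∀ hρ, HThm4RecMember F N Mc (ρ₀·L) hρ (b9OfP F Mc (ρ₀·L) B₁) (a0OfP F N Mc (ρ₀·L) B₁ c₁)`;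
   ★ `…_uniform_of_datumCrownAt_sideP` (the crown's own constants at every collar).

HONEST SCOPE ∕ NOT CLAIMED.  CONDITIONAL on the displayed premise `DatumCrownAt` (R6 at the datum: dag-n05-e's record crown, NOT yet landed; the adapter «crown → `DatumCrownAt`»
is the next file of this lineage) exactly like p721358; real arithmetic only; nothing of [6] ∕ [15] ∕ [I] newly asserted; `HThm4Rec(Dbar)` UNDISCHARGED; the row-9 junction
(`HThm4RecMember → HThm4RecDbar`, ⚑ LOCATED-NRM-ROW-CURRENCY, ruling A3⁵ pending) untouched; N05 ∕ N07 NOT discharged; COUNT of record 8∕27 UNMOVED · K numerically unchanged;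
one finite `𝕋⁴` programme at fixed `ε`, Bałaban AS PRINTED; R4 closes the CONDITIONAL finite-`𝕋⁴` rung `BalabanLadder.UV` only; the YM mass gap (Clay) is NOT proved by any of
this; nothing continuum ∕ ℝ⁴ ∕ OS.  No `sorry`, no `def`, no `instance`, no `notation`; `--supports stmt-QuantumFields-20541 --as helper`.

[cite: Balaban1985RegularSpaces, Prop. 6 (1.130)–(1.138) p.99, Thm. 4 p.88; Balaban1985Variational, (144) p.300, (152)–(153) p.301, (163) p.304; Balaban1987RG1, (0.4) p.253, (0.11) pp.253–254]
-/

noncomputable section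

open scoped BigOperators Matrix.Norms.L2Operator

namespace Summit.QuantumFields.YangMills.BalabanUVNodes.N07Thm4RecMemberPrintLetters

open Literature.MathematicalPhysics.QuantumFieldTheory.Balaban1983to89
open Literature.MathematicalPhysics.QuantumFieldTheory.Balaban1983to89.Node00
open T4Continuum (T4Family)
open Summit.QuantumFields.YangMills.BalabanUVNodes.N07Thm4RecMemberOfCrown (DatumCrownAt HThm4RecMember hThm4RecMember_of_datumCrownAt)

variable (F : T4Family) (N : ℕ) [NeZero N]

/-! ## §1  The print letters unfolded (bookkeeping) -/

/-- `b9OfP` at `B₁ := 20·L⁴·B₀` is `2240·L⁹·B₀·(L·Mc + 44 + 2ρ) + 1`. [cite: Balaban1985Variational, (152) p.301 (bookkeeping)] -/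
theorem b9OfP_twenty (Mc ρ : ℕ) (B₀ : ℝ) :
    b9OfP F Mc ρ (20 * (F.L : ℝ) ^ 4 * B₀) = 2240 * (F.L : ℝ) ^ 9 * B₀ * ((F.L * Mc + 44 + 2 * ρ : ℕ) : ℝ) + 1 := by
  unfold b9OfP; ring

omit [NeZero N] in
/-- `a0OfP ≤ c₁ ∕ (56·L⁵·(L·Mc + 44 + 2ρ))` (first branch of the `min`). [cite: Balaban1985Variational, (152) p.301 («9dL²Mε₀ ≦ c₁»; bookkeeping)] -/
theorem a0OfP_le_first (Mc ρ : ℕ) (B₁ c₁ : ℝ) :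
    a0OfP F N Mc ρ B₁ c₁ ≤ c₁ / (56 * (F.L : ℝ) ^ 5 * ((F.L * Mc + 44 + 2 * ρ : ℕ) : ℝ)) := by
  unfold a0OfP; exact min_le_left _ _

omit [NeZero N] in
/-- `a0OfP ≤ 1 ∕ (8·(L·Mc + 44 + 2ρ)·N·(28·L⁵·B₁·(L·Mc + 44 + 2ρ)) + 1)` (second branch of the `min`: the `2π` window). [cite: Balaban1985Variational, (152)–(153) p.301 (bookkeeping)] -/
theorem a0OfP_le_second (Mc ρ : ℕ) (B₁ c₁ : ℝ) :
    a0OfP F N Mc ρ B₁ c₁ ≤ 1 / (8 * ((F.L * Mc + 44 + 2 * ρ : ℕ) : ℝ) * N * (28 * (F.L : ℝ) ^ 5 * B₁ * ((F.L * Mc + 44 + 2 * ρ : ℕ) : ℝ)) + 1) := by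
  unfold a0OfP; exact min_le_right _ _

/-! ## §2  The member-row premise at the print letters from the datum crown -/

/-- ★★ **`HThm4RecMember` AT THE PRINT LETTERS `b9OfP ∕ a0OfP` FROM THE DATUM CROWN**: if R6's crown holds at the print datum with a radius constant `0 ≤ Cr ≤ 560·L³·B₀·(L·Mc + 44 + 2ρ)`
(= [6] Prop. 6's `7·d·L²·(5dLB₀)·M′` at `d = 4`, `M′ ≤ L·Mc + 44 + 2ρ`) and a tolerance ceiling `α₁ ≥ c₁ ∕ (56·L²·(L·Mc + 44 + 2ρ))` (⊒ the guard «`7dL²·M′·α₀ ≤ c₁`»), then the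
member-row premise holds at [15] (152)'s letter `κ := b9OfP F Mc ρ (20·L⁴·B₀)` and ceiling `a₀ := a0OfP F N Mc ρ (20·L⁴·B₀) c₁` — p721358's `hThm4RecMember_of_datumCrownAt` with its
three side conditions discharged by real arithmetic: `4·Cr·L⁶ ≤ b9OfP − 1`, `L³·a₀ ≤ c₁∕(56L²S′) ≤ α₁`, `4N·Cr·L³·a₀ ≤ 1 < 2π`.
[cite: Balaban1985RegularSpaces, Prop. 6 (1.130)–(1.138) p.99; Balaban1985Variational, (152)–(153) p.301; Balaban1987RG1, (0.4) p.253] -/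
theorem hThm4RecMember_printLetters_of_datumCrownAt {Mc ρ : ℕ} (hρ : F.L ≤ ρ) {Cr α₁ B₀ c₁ : ℝ} (hB₀ : 0 < B₀) (hc₁ : 0 < c₁) (hCr : 0 ≤ Cr)
    (hCrB : Cr ≤ 560 * (F.L : ℝ) ^ 3 * B₀ * ((F.L * Mc + 44 + 2 * ρ : ℕ) : ℝ))
    (hα₁ : c₁ / (56 * (F.L : ℝ) ^ 2 * ((F.L * Mc + 44 + 2 * ρ : ℕ) : ℝ)) ≤ α₁)
    (hcrown : DatumCrownAt F N Mc ρ hρ Cr α₁) :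
    HThm4RecMember F N Mc ρ hρ (b9OfP F Mc ρ (20 * (F.L : ℝ) ^ 4 * B₀)) (a0OfP F N Mc ρ (20 * (F.L : ℝ) ^ 4 * B₀) c₁) := by
  set S : ℝ := ((F.L * Mc + 44 + 2 * ρ : ℕ) : ℝ) with hS
  set L : ℝ := (F.L : ℝ) with hLdef
  set a₀ : ℝ := a0OfP F N Mc ρ (20 * L ^ 4 * B₀) c₁ with ha₀
  have hL1 : (1 : ℝ) ≤ L := by rw [hLdef]; exact_mod_cast (F.P 0).L_pos
  have hL0 : (0 : ℝ) < L := by linarith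
  have hS44 : (44 : ℝ) ≤ S := by
    rw [hS]; push_cast
    have h1 : (0 : ℝ) ≤ (F.L : ℝ) * (Mc : ℝ) := by positivity
    have h2 : (0 : ℝ) ≤ (ρ : ℝ) := by positivity
    linarith
  have hS0 : (0 : ℝ) < S := by linarith
  have hN0 : (0 : ℝ) ≤ N := Nat.cast_nonneg N
  have hB₁ : (0 : ℝ) ≤ 20 * L ^ 4 * B₀ := by positivity
  have ha₀0 : 0 ≤ a₀ := (a0OfP_pos (F := F) (N := N) Mc ρ hB₁ hc₁).le
  -- (i) the (152)-letter: `4·Cr·L⁶ < b9OfP`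
  have hκ : 4 * Cr * L ^ 6 < b9OfP F Mc ρ (20 * L ^ 4 * B₀) := by
    rw [b9OfP_twenty]
    have h1 : 4 * Cr * L ^ 6 ≤ 4 * (560 * L ^ 3 * B₀ * S) * L ^ 6 := by gcongr
    have h2 : 4 * (560 * L ^ 3 * B₀ * S) * L ^ 6 = 2240 * L ^ 9 * B₀ * S := by ring
    linarith
  -- (ii) the tolerance ceiling: `L³·a₀ ≤ α₁`
  have hα : L ^ 3 * a₀ ≤ α₁ := by
    have h1 : a₀ ≤ c₁ / (56 * L ^ 5 * S) := a0OfP_le_first F N Mc ρ _ c₁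
    have h2 : L ^ 3 * a₀ ≤ L ^ 3 * (c₁ / (56 * L ^ 5 * S)) := mul_le_mul_of_nonneg_left h1 (by positivity)
    have h3 : L ^ 3 * (c₁ / (56 * L ^ 5 * S)) = c₁ / (56 * L ^ 2 * S) := by
      field_simp
    linarith [h3 ▸ h2]
  -- (iii) the `2π` window: `4N·Cr·L³·a₀ ≤ 1 < 2π`
  have hwin : 4 * ((N : ℝ) * (Cr * (L ^ 3 * a₀))) < 2 * Real.pi := by
    set D : ℝ := 8 * S * N * (28 * L ^ 5 * (20 * L ^ 4 * B₀) * S) + 1 with hD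
    have hD0 : 0 < D := by positivity
    have h1 : a₀ ≤ 1 / D := a0OfP_le_second F N Mc ρ _ c₁
    have hX0 : 0 ≤ 2240 * (N : ℝ) * L ^ 6 * B₀ * S := by positivity
    have h2 : 4 * ((N : ℝ) * (Cr * (L ^ 3 * a₀))) ≤ 2240 * (N : ℝ) * L ^ 6 * B₀ * S * a₀ := by
      have : (N : ℝ) * (Cr * (L ^ 3 * a₀)) ≤ (N : ℝ) * (560 * L ^ 3 * B₀ * S * (L ^ 3 * a₀)) := by
        apply mul_le_mul_of_nonneg_left _ hN0
        exact mul_le_mul_of_nonneg_right hCrB (by positivity)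
      nlinarith [this]
    have h3 : 2240 * (N : ℝ) * L ^ 6 * B₀ * S * a₀ ≤ 2240 * (N : ℝ) * L ^ 6 * B₀ * S * (1 / D) := mul_le_mul_of_nonneg_left h1 hX0
    have h4 : 2240 * (N : ℝ) * L ^ 6 * B₀ * S ≤ D := by
      have hLS : (1 : ℝ) ≤ L ^ 3 * S := by
        have : (1 : ℝ) ≤ L ^ 3 := one_le_pow₀ hL1
        nlinarith
      have : 2240 * (N : ℝ) * L ^ 6 * B₀ * S * 1 ≤ 2240 * (N : ℝ) * L ^ 6 * B₀ * S * (2 * (L ^ 3 * S)) :=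
        mul_le_mul_of_nonneg_left (by linarith) hX0
      have hD' : D = 2240 * (N : ℝ) * L ^ 6 * B₀ * S * (2 * (L ^ 3 * S)) + 1 := by rw [hD]; ring
      linarith
    have h5 : 2240 * (N : ℝ) * L ^ 6 * B₀ * S * (1 / D) ≤ 1 := by
      rw [mul_one_div]; exact div_le_one_of_le₀ h4 hD0.le
    have hπ : (1 : ℝ) < 2 * Real.pi := by linarith [Real.pi_gt_three]
    linarith
  exact hThm4RecMember_of_datumCrownAt hρ hCr hcrown hκ hα hwin

/-- ★ **The same at the crown's OWN constants** `Cr := 560·L³·B₀·M′` (= `7·d·L²·(5dLB₀)·M′`, `d = 4`) and `α₁ := c₁ ∕ (28·L²·M′)` (= the guard «`7dL²·M′·α₀ ≤ c₁`»), `M′ = sideP (F.P 0) Mc ρ`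
(the print side of the datum, `M′ ≤ Mc + 44 + 2ρ ≤ L·Mc + 44 + 2ρ` by `sideP_le`). [cite: Balaban1985RegularSpaces, Prop. 6 (1.130), (1.135)–(1.138) p.99, p.98 («M is a multiple of R₁M₁»); Balaban1985Variational, (152)–(153) p.301] -/
theorem hThm4RecMember_printLetters_of_datumCrownAt_sideP {Mc ρ : ℕ} (hρ : F.L ≤ ρ) {B₀ c₁ : ℝ} (hB₀ : 0 < B₀) (hc₁ : 0 < c₁)
    (hcrown : DatumCrownAt F N Mc ρ hρ (560 * (F.L : ℝ) ^ 3 * B₀ * (sideP (F.P 0) Mc ρ : ℝ)) (c₁ / (28 * (F.L : ℝ) ^ 2 * (sideP (F.P 0) Mc ρ : ℝ)))) :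
    HThm4RecMember F N Mc ρ hρ (b9OfP F Mc ρ (20 * (F.L : ℝ) ^ 4 * B₀)) (a0OfP F N Mc ρ (20 * (F.L : ℝ) ^ 4 * B₀) c₁) := by
  have hL1 : 1 ≤ F.L := (F.P 0).L_pos
  have hLr : (1 : ℝ) ≤ F.L := by exact_mod_cast hL1
  have hρ0 : 0 < ρ := lt_of_lt_of_le hL1 hρ
  have hsd : sideP (F.P 0) Mc ρ ≤ F.L * Mc + 44 + 2 * ρ := by
    have h := sideP_le (P := F.P 0) Mc ρ
    have hd : (F.P 0).d = 4 := T4Family.P_d F 0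
    rw [hd] at h
    have : Mc ≤ F.L * Mc := Nat.le_mul_of_pos_left Mc hL1
    omega
  have hsd1 : 1 ≤ sideP (F.P 0) Mc ρ := by
    have h := le_sideP (P := F.P 0) Mc hρ0
    omega
  have hsdR : (sideP (F.P 0) Mc ρ : ℝ) ≤ ((F.L * Mc + 44 + 2 * ρ : ℕ) : ℝ) := by exact_mod_cast hsd
  have hsd0 : (0 : ℝ) < (sideP (F.P 0) Mc ρ : ℝ) := by exact_mod_cast hsd1
  refine hThm4RecMember_printLetters_of_datumCrownAt F N hρ hB₀ hc₁ (by positivity) ?_ ?_ hcrown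
  · exact mul_le_mul_of_nonneg_left hsdR (by positivity)
  · -- `c₁ ∕ (56·L²·S′) ≤ c₁ ∕ (28·L²·M′)` since `28·L²·M′ ≤ 56·L²·S′`
    apply div_le_div_of_nonneg_left hc₁.le (by positivity)
    nlinarith [hsdR, hsd0, sq_nonneg (F.L : ℝ)]

/-! ## §3  The collar-uniform shape (MODULE 88″ §2's quantifiers, `HThm4RecDbar ↦ HThm4RecMember`) -/

/-- ★★ **THE COLLAR-UNIFORM MEMBER-ROW PREMISE FROM THE DATUM CROWN AT EVERY ADMISSIBLE COLLAR**: if for every `ρ₀ ≥ 1` with `ρmin ∣ ρ₀` the datum crown holds at the collar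
`ρ₀·L` with a radius constant `0 ≤ Cr ρ₀ ≤ 560·L³·B₀·(L·Mc + 44 + 2ρ₀L)` and a ceiling `α₁ ρ₀ ≥ c₁ ∕ (56·L²·(L·Mc + 44 + 2ρ₀L))` (`B₀, c₁` UNIFORM — [6] Prop. 6 p. 99 «there exist
constants B₁, c₁» over the big-block class), then ONE witness `(B₁, c₁′) := (20·L⁴·B₀, c₁)` gives the member-row premise at the print letters at every such collar — the text of
dag-n07-e's `HThm4RecDbarUniform F N Mc` (88″ §2) with `HThm4RecDbar ↦ HThm4RecMember` (the K0 assembler picks the collar AFTER `B₁`, as print does at [15] (163)).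
[cite: Balaban1985RegularSpaces, Prop. 6 p.99, Thm. 4 p.88; Balaban1985Variational, (144) p.300, (152) p.301, (163) p.304; Balaban1987RG1, (0.11) pp.253–254] -/
theorem hThm4RecMember_printLetters_uniform_of_datumCrownAt {Mc ρmin : ℕ} {B₀ c₁ : ℝ} (hB₀ : 0 < B₀) (hc₁ : 0 < c₁) (Cr α₁ : ℕ → ℝ)
    (hCr : ∀ ρ₀, 0 ≤ Cr ρ₀) (hCrB : ∀ ρ₀, Cr ρ₀ ≤ 560 * (F.L : ℝ) ^ 3 * B₀ * ((F.L * Mc + 44 + 2 * (ρ₀ * F.L) : ℕ) : ℝ))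
    (hα₁ : ∀ ρ₀, c₁ / (56 * (F.L : ℝ) ^ 2 * ((F.L * Mc + 44 + 2 * (ρ₀ * F.L) : ℕ) : ℝ)) ≤ α₁ ρ₀)
    (hall : ∀ ρ₀, ρmin ∣ ρ₀ → 1 ≤ ρ₀ → ∀ hρ : F.L ≤ ρ₀ * F.L, DatumCrownAt F N Mc (ρ₀ * F.L) hρ (Cr ρ₀) (α₁ ρ₀)) :
    ∃ B₁ c₁' : ℝ, 0 ≤ B₁ ∧ 0 < c₁' ∧ ∀ ρ₀ : ℕ, ρmin ∣ ρ₀ → 1 ≤ ρ₀ → ∀ hρ : F.L ≤ ρ₀ * F.L,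
      HThm4RecMember F N Mc (ρ₀ * F.L) hρ (b9OfP F Mc (ρ₀ * F.L) B₁) (a0OfP F N Mc (ρ₀ * F.L) B₁ c₁') := by
  refine ⟨20 * (F.L : ℝ) ^ 4 * B₀, c₁, by positivity, hc₁, fun ρ₀ hd h1 hρ => ?_⟩
  exact hThm4RecMember_printLetters_of_datumCrownAt F N hρ hB₀ hc₁ (hCr ρ₀) (hCrB ρ₀) (hα₁ ρ₀) (hall ρ₀ hd h1 hρ)

/-- ★ **The collar-uniform shape at the crown's own constants** (`Cr := 560·L³·B₀·M′(ρ₀L)`, `α₁ := c₁ ∕ (28·L²·M′(ρ₀L))`, `M′(ρ) = sideP (F.P 0) Mc ρ`): from the datum crown at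
every admissible collar, ONE witness `(20·L⁴·B₀, c₁)` for 88″ §2's quantifiers with `HThm4RecDbar ↦ HThm4RecMember`. [cite: Balaban1985RegularSpaces, Prop. 6 (1.130)–(1.138) p.99; Balaban1985Variational, (152) p.301, (163) p.304; Balaban1987RG1, (0.11) pp.253–254] -/
theorem hThm4RecMember_printLetters_uniform_of_datumCrownAt_sideP {Mc ρmin : ℕ} {B₀ c₁ : ℝ} (hB₀ : 0 < B₀) (hc₁ : 0 < c₁)
    (hall : ∀ ρ₀, ρmin ∣ ρ₀ → 1 ≤ ρ₀ → ∀ hρ : F.L ≤ ρ₀ * F.L,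
      DatumCrownAt F N Mc (ρ₀ * F.L) hρ (560 * (F.L : ℝ) ^ 3 * B₀ * (sideP (F.P 0) Mc (ρ₀ * F.L) : ℝ)) (c₁ / (28 * (F.L : ℝ) ^ 2 * (sideP (F.P 0) Mc (ρ₀ * F.L) : ℝ)))) :
    ∃ B₁ c₁' : ℝ, 0 ≤ B₁ ∧ 0 < c₁' ∧ ∀ ρ₀ : ℕ, ρmin ∣ ρ₀ → 1 ≤ ρ₀ → ∀ hρ : F.L ≤ ρ₀ * F.L,
      HThm4RecMember F N Mc (ρ₀ * F.L) hρ (b9OfP F Mc (ρ₀ * F.L) B₁) (a0OfP F N Mc (ρ₀ * F.L) B₁ c₁') := by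
  refine ⟨20 * (F.L : ℝ) ^ 4 * B₀, c₁, by positivity, hc₁, fun ρ₀ hd h1 hρ => ?_⟩
  exact hThm4RecMember_printLetters_of_datumCrownAt_sideP F N hρ hB₀ hc₁ (hall ρ₀ hd h1 hρ)

/-- Bookkeeping: every `ρ₀ ≥ 1` gives an admissible collar `F.L ≤ ρ₀·F.L` (the `hρ` the statements above quantify over is always available). [cite: Balaban1985Variational, (144) p.300 (bookkeeping)] -/
theorem le_mul_collar {ρ₀ : ℕ} (h : 1 ≤ ρ₀) : F.L ≤ ρ₀ * F.L := Nat.le_mul_of_pos_left F.L h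

end Summit.QuantumFields.YangMills.BalabanUVNodes.N07Thm4RecMemberPrintLetters

end
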